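import Mathlib

/-!
# B16 (1.71): the point-group average of a translation-covariant prescription is covariant under the full group

Reproduction (statement-level, abstract) of the algebraic mechanism behind Balaban, *Large field renormalization. II*,
Comm. Math. Phys. 122 (1989) 355–392, (1.71) p. 378–379 and p. 390 («By their construction it is also clear that they are
Euclidean covariant, i.e., they have the property (2.32) [III]»), with Balaban, *Large field renormalization. I*, CMP 122
(1989) 175–202, p. 201 («these averages can be replaced by … averages over d! permutations of coordinates, and 2^d reflections
in subsets of coordinates»).  The print averages only over the finite point group `H` (2^d d! elements); covariance under the
group `G_k` of [III] (2.32) — which contains the translations by cube multiples — needs in addition that the un-averaged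
prescription is covariant under the translation subgroup `N` and that `N` is normalised by `H`.  Cell GAPS G-adv3-36.

Abstractly: a group `Γ` acts on `X` (configurations / domains) and additively on `Y` (the values); `f : X → Y` is `N`-equivariant
for a normal subgroup `N`; the `H`-average `F x = Σ_{h ∈ H} h • f (h⁻¹ • x)` is then equivariant under `N`, under `H`, hence under
the subgroup they generate.  Nothing about lattices is asserted; this is the bookkeeping the sentence «it is also clear» uses.
[cite: Balaban1989LargeFieldII, (1.71) p.378–379, p.390; Balaban1989LargeFieldI, p.201; Balaban1988Convergent, (2.32) p.260]
-/

namespace Literature.MathematicalPhysics.QuantumFieldTheory.Balaban1983to89.B16PointGroupAverage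

variable {Γ X Y : Type*} [Group Γ] [MulAction Γ X] [AddCommMonoid Y] [DistribMulAction Γ Y]

/-- The `H`-average of the prescription `f`: `F x = Σ_{h ∈ H} h • f (h⁻¹ • x)` ((1.71): `1/(2^d d!) Σ_r … δ_{rT} …`, the
normalising constant omitted — it is a scalar and does not affect equivariance). [cite: Balaban1989LargeFieldII, (1.71) p.378] -/
noncomputable def avg (H : Subgroup Γ) [Fintype H] (f : X → Y) (x : X) : Y :=
  ∑ h : H, (h : Γ) • f ((h : Γ)⁻¹ • x)

/-- `f` is equivariant under the subgroup `S` (the shape of (2.32) [III]). [cite: Balaban1988Convergent, (2.32) p.260] -/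
def Equivariant (S : Subgroup Γ) (f : X → Y) : Prop :=
  ∀ s ∈ S, ∀ x : X, f (s • x) = s • f x

/-- H-covariance of the average is a re-indexing of the finite sum (the «2^d d!» sum of (1.71)); no hypothesis on `f`. [cite: Balaban1989LargeFieldI, p.201] -/
theorem avg_equivariant_H (H : Subgroup Γ) [Fintype H] (f : X → Y) : Equivariant H (avg H f) := by
  intro s hs x
  unfold avg
  rw [Finset.smul_sum]
  let e : H ≃ H := Equiv.mulLeft ⟨s, hs⟩
  rw [← e.sum_comp]
  refine Finset.sum_congr rfl fun h _ => ?_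
  have h1 : ((e h : H) : Γ) = s * (h : Γ) := rfl
  rw [h1, mul_inv_rev, mul_smul, mul_smul, inv_smul_smul]

/-- Translation covariance survives the average because the translations are normalised by the point group; the
un-averaged prescription must be translation-covariant (B15 p.196, given a covariant rule for the number `a`). [folklore] -/
theorem avg_equivariant_N (H N : Subgroup Γ) [Fintype H] [N.Normal] (f : X → Y) (hf : Equivariant N f) :
    Equivariant N (avg H f) := by
  intro n hn x
  unfold avg
  rw [Finset.smul_sum]
  refine Finset.sum_congr rfl fun h _ => ?_
  have hmem : (h : Γ)⁻¹ * n * (h : Γ) ∈ N := Subgroup.Normal.conj_mem' ‹N.Normal› n hn (h : Γ)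
  have : (h : Γ)⁻¹ • n • x = ((h : Γ)⁻¹ * n * (h : Γ)) • ((h : Γ)⁻¹ • x) := by
    simp only [mul_smul, smul_inv_smul]
  rw [this, hf _ hmem, smul_smul, smul_smul]
  congr 1
  group

/-- The subgroup of `Γ` under which a fixed map is equivariant. [folklore] -/
def equivariantSubgroup (F : X → Y) : Subgroup Γ where
  carrier := {g | ∀ x, F (g • x) = g • F x}
  one_mem' := by intro x; simp
  mul_mem' := by
    intro a b ha hb x
    simp only [Set.mem_setOf_eq] at ha hb ⊢
    rw [mul_smul, ha, hb, mul_smul]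
  inv_mem' := by
    intro a ha x
    simp only [Set.mem_setOf_eq] at ha ⊢
    have := ha (a⁻¹ • x)
    rw [smul_inv_smul] at this
    rw [this, inv_smul_smul]

/-- The `H`-average of an `N`-equivariant prescription is equivariant under the subgroup generated by `N` and `H`
(for the lattice: the translations by cube multiples together with the hyperoctahedral point group generate the group `G_k`
of (2.32) [III] — a geometric fact NOT asserted here). [cite: Balaban1989LargeFieldII, p.390] -/
theorem avg_equivariant_sup (H N : Subgroup Γ) [Fintype H] [N.Normal] (f : X → Y) (hf : Equivariant N f) :
    Equivariant (N ⊔ H) (avg H f) := by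
  intro s hs x
  have hN : N ≤ equivariantSubgroup (avg H f) := fun n hn => avg_equivariant_N H N f hf n hn
  have hH : H ≤ equivariantSubgroup (avg H f) := fun h hh => avg_equivariant_H H f h hh
  exact (sup_le hN hH) hs x

end Literature.MathematicalPhysics.QuantumFieldTheory.Balaban1983to89.B16PointGroupAverage
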